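/-
Copyright (c) 2026. All rights reserved.
Released under Apache 2.0 license as described in the file LICENSE.
Authors: abc-iut cell, block C / W6 prover seat abc-iut-w6-d060 (gen 3).
-/
import Literature.IUT.LogVolume.UnitLogFirstTieLevel
import Literature.IUT.LogVolume.UnitLogBallVolumeCriterion
import HarnessLib

/-!
# `log_p(𝒪_K^×)` at the FIRST TIE LEVEL `s = e/(p−1)`, II: `p`-th powers and `p`-th roots of unity

PROOF-ONLY sequel (no `def`, no named fact) of `UnitLogFirstTieLevel.lean` (abc-iut-w6-d060; setting `K` a
proper ultrametric normed `ℚ_p`-algebra field, `p` odd, `e = absRamificationIdx p K = s·(p−1)`, `ϖ` a norm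
uniformizer, `c = ϖ^{s(p−1)}/p`).  Classical (Serre, *Local Fields* IV §2 Prop. 6; Washington §5.1; Neukirch
II (5.5)–(5.7), (7.13)).  Valid for EVERY `s` (no hypothesis `p ∤ s` in this part):

* §4 `p`-TH POWERS: `‖(1 + w)^p − 1 − w^p‖ ≤ ‖p‖·‖w‖`; **below the tie the `p`-th power multiplies the level by
  `p`** (`‖1 − y‖ = ‖ϖ‖ᵏ`, `k < s ⇒ ‖1 − y^p‖ = ‖ϖ‖^{pk}`, iterated `‖1 − y^{pᵗ}‖ = ‖ϖ‖^{pᵗk}` while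
  `p^{t−1}k < s`); at the tie it lands strictly inside (`‖1 − y‖ ≤ ‖ϖ‖ˢ ⇒ ‖1 − y^p‖ ≤ ‖ϖ‖^{s+1}`);
* §5 ROOTS OF UNITY: `ζ^p = 1 ≠ ζ ⇒ ‖1 − ζ‖ = ‖ϖ‖ˢ` (abc-iut-w5-d039's `‖1 − ζ‖^{p−1} = ‖p‖`) and
  `(ζ − 1)/ϖˢ` is a UNIT ZERO of the residue polynomial `ā ↦ ā + c̄·ā^p`; conversely a unit zero LIFTS to a
  non-trivial `p`-th root of unity (`log_p(1 + ϖˢa) ∈ 𝔪^{s+1} = log_p(U^{(s+1)})`, so `1 + ϖˢa = ζ·u`, `u ∈ U^{(s+1)}`,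
  `log_p ζ = 0`, `ζ^p ∈ U^{(s+1)}` by §4, injectivity); hence the CRITERION
  **`K ∋ ζ_p ≠ 1 ⟺ ∃ a ∈ 𝒪^×, a + c·a^p ∈ 𝔪 ⟺ ∃ x ∈ K, ‖x^{p−1} + p‖ < ‖p‖`**
  (`exists_pow_prime_eq_one_ne_one_iff_exists_unit_zero` / `…_iff_exists_norm_pow_add_lt`).

The residue-field algebra (`addPoly_*`) and the `K ↔ k` transfer lemmas of `UnitLogBoundaryRamificationRoots`
are reused BY NAME with `C = (ϖˢ)^{p−1}/p`.  References: [cite: SerreLocalFields1979, Ch. IV §2]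
[cite: NeukirchANT1999, Ch. II Prop. (5.5)–(5.7), (7.13)] [cite: Washington1997, Lemma 1.4, §5.1]
[cite: Koblitz1984, Ch. IV §2].  Nothing here is disputed
mathematics; no IUT statement is asserted; the name `logUnits` is the cell's typing of [IUTchIV] Prop. 1.2's
`log_p(R^×)` ([claim: Mochizuki2012, status: disputed] for that locution only).  No side is taken on
[IUTchIII] Cor. 3.12 or on any author.
-/

noncomputable section

open Metric Set IsUltrametricDist IsLocalRing
open scoped Pointwise NormedField

namespace Literature.IUT.LogVolume

open Literature.NumberTheory.GaloisRepresentations.Ultrametric Literature.NumberTheory.Transcendental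
  BoundaryRamification

namespace FirstTieLevel

variable (p : ℕ) [hp : Fact p.Prime]
variable {K : Type*} [NontriviallyNormedField K] [instK : NormedAlgebra ℚ_[p] K] [IsUltrametricDist K]
  [ProperSpace K]

/-! ## 3b. Units of level `≥ s`: `1 + ϖˢ·a` -/

section LevelUnits

variable {ϖ : Kˣ} (hϖ : IsUniformizer ϖ) {s : ℕ} (he : absRamificationIdx p K = s * (p - 1))
include hϖ he

omit [IsUltrametricDist K] [ProperSpace K] hϖ he in
/-- A unit `y` with `‖1 − y‖ ≤ ‖ϖ‖ˢ` is `1 + ϖˢ·a` with `a ∈ 𝒪`. [cite: NeukirchANT1999, Ch. II Prop. (5.3)] -/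
theorem exists_eq_one_add_pow_mul_of_le {y : K} (hy : ‖1 - y‖ ≤ ‖(ϖ : K)‖ ^ s) :
    ∃ a : K, ‖a‖ ≤ 1 ∧ y = 1 + (ϖ : K) ^ s * a := by
  have hϖ0 : (ϖ : K) ^ s ≠ 0 := pow_ne_zero _ ϖ.ne_zero
  have hr0 : 0 < ‖(ϖ : K)‖ ^ s := pow_pos (norm_units_pos ϖ) s
  refine ⟨(y - 1) / (ϖ : K) ^ s, ?_, ?_⟩
  · rw [norm_div, norm_pow, div_le_one hr0, ← norm_neg, neg_sub]
    exact hy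
  · rw [mul_div_cancel₀ _ hϖ0]; ring

omit [IsUltrametricDist K] [ProperSpace K] hϖ he in
/-- `1 + ϖˢ·a` (`a ∈ 𝒪`, `s ≥ 1`) is a principal unit with `‖1 − (1 + ϖˢa)‖ ≤ ‖ϖ‖ˢ`.
[cite: NeukirchANT1999, Ch. II Prop. (5.3)] -/
theorem norm_one_sub_one_add_pow_mul_le {a : K} (ha : ‖a‖ ≤ 1) :
    ‖1 - (1 + (ϖ : K) ^ s * a)‖ ≤ ‖(ϖ : K)‖ ^ s := by
  rw [sub_add_cancel_left, norm_neg, norm_mul, norm_pow]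
  exact mul_le_of_le_one_right (by positivity) ha

/-- `1 + ϖˢ·a` (`a ∈ 𝒪`) is a principal unit. [cite: NeukirchANT1999, Ch. II Prop. (5.3)] -/
theorem isPrincipal_one_add_pow_mul {a : K} (ha : ‖a‖ ≤ 1) : IsPrincipal (1 + (ϖ : K) ^ s * a) := by
  have h1 := one_le_level p he
  exact (norm_one_sub_one_add_pow_mul_le ha).trans_lt
    (pow_lt_one₀ (norm_nonneg _) hϖ.norm_lt_one (by omega))

/-- `log_p(1 + ϖˢ·a) ∈ log_p(𝒪^×)` for `a ∈ 𝒪`. [cite: NeukirchANT1999, Ch. II Prop. (5.5)] -/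
theorem logSeries_one_add_pow_mul_mem_logUnits {a : K} (ha : ‖a‖ ≤ 1) :
    logSeries (1 + (ϖ : K) ^ s * a) ∈ logUnits K := by
  have hyP := isPrincipal_one_add_pow_mul p hϖ he ha
  rw [← unitLog_of_isPrincipal p hyP]
  exact unitLog_mem_logUnits hyP.norm_eq_one

end LevelUnits

/-! ## 4. `p`-th powers: the level `k ↦ p·k` below the tie, `≥ s ↦ ≥ s + 1` at the tie -/

section PthPower

variable {ϖ : Kˣ} (hϖ : IsUniformizer ϖ) {s : ℕ} (he : absRamificationIdx p K = s * (p - 1))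
include hϖ he

omit instK [ProperSpace K] hϖ he in
/-- Binomial theorem in `𝒪`: **`‖(1 + w)^p − 1 − w^p‖ ≤ ‖p‖·‖w‖`** for `w ∈ 𝒪` (`(w + 1)^p = w^p + 1 + p·w·R`,
`R ∈ 𝒪`, Mathlib `exists_add_pow_prime_eq`). [cite: NeukirchANT1999, Ch. II Prop. (5.5)] -/
theorem norm_one_add_pow_prime_sub_sub_le {w : K} (hw : ‖w‖ ≤ 1) :
    ‖(1 + w) ^ p - 1 - w ^ p‖ ≤ ‖(p : K)‖ * ‖w‖ := by
  let W : Valued.integer K := ⟨w, Valued.integer.mem_iff.mpr hw⟩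
  obtain ⟨R, hR⟩ := exists_add_pow_prime_eq hp.out W 1
  have hRn : ‖(R : K)‖ ≤ 1 := Valued.integer.norm_le_one R
  have hK : (w + 1) ^ p = w ^ p + 1 + (p : K) * w * R := by
    have h := congrArg (fun z : Valued.integer K => (z : K)) hR
    simpa [W] using h
  have hrew : (1 + w) ^ p - 1 - w ^ p = (p : K) * w * R := by
    rw [add_comm, hK]; ring
  rw [hrew, norm_mul, norm_mul]
  exact mul_le_of_le_one_right (by positivity) hRn

/-- **Below the tie level the `p`-th power multiplies the level by `p`**: if `‖w‖ = ‖ϖ‖ᵏ` with `k < s`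
(`e = s(p−1)`) then `‖(1 + w)^p − 1‖ = ‖ϖ‖^{pk}` EXACTLY (`‖w^p‖ = ‖ϖ‖^{pk} > ‖ϖ‖^{e+k} ≥ ‖p·w·R‖`
since `pk < e + k ⟺ k < s`). [cite: SerreLocalFields1979, Ch. IV §2 Prop. 6] [cite: NeukirchANT1999, Ch. II Prop. (5.5)] -/
theorem norm_one_add_pow_prime_sub_one_eq {w : K} {k : ℕ} (hw : ‖w‖ = ‖(ϖ : K)‖ ^ k) (hk : k < s) :
    ‖(1 + w) ^ p - 1‖ = ‖(ϖ : K)‖ ^ (p * k) := by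
  have hr0 : 0 < ‖(ϖ : K)‖ := norm_units_pos ϖ
  have hr1 : ‖(ϖ : K)‖ < 1 := hϖ.norm_lt_one
  have hw1 : ‖w‖ ≤ 1 := by rw [hw]; exact pow_le_one₀ hr0.le hr1.le
  have hmain : ‖w ^ p‖ = ‖(ϖ : K)‖ ^ (p * k) := by rw [norm_pow, hw, ← pow_mul, mul_comm]
  have hsmall : ‖(1 + w) ^ p - 1 - w ^ p‖ < ‖w ^ p‖ := by
    refine (norm_one_add_pow_prime_sub_sub_le p hw1).trans_lt ?_
    rw [hmain, norm_prime_eq_norm_pow_level p hϖ he, hw, ← pow_add]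
    refine pow_lt_pow_right_of_lt_one₀ hr0 hr1 ?_
    have hq0 : 0 < p - 1 := by have := hp.out.two_le; omega
    have h1 : (p - 1) * k < (p - 1) * s := Nat.mul_lt_mul_of_pos_left hk hq0
    have h2 : (p - 1) * k + k = p * k := by
      rw [Nat.sub_one_mul, Nat.sub_add_cancel (Nat.le_mul_of_pos_left k hp.out.pos)]
    rw [← h2, mul_comm s]
    exact Nat.add_lt_add_right h1 k
  calc ‖(1 + w) ^ p - 1‖ = ‖((1 + w) ^ p - 1 - w ^ p) + w ^ p‖ := by rw [sub_add_cancel]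
    _ = ‖w ^ p‖ := norm_add_eq_max_of_norm_ne_norm hsmall.ne |>.trans (max_eq_right hsmall.le)
    _ = ‖(ϖ : K)‖ ^ (p * k) := hmain

/-- The same in terms of `y = 1 + w`: **`‖1 − y‖ = ‖ϖ‖ᵏ`, `k < s` ⇒ `‖1 − y^p‖ = ‖ϖ‖^{pk}`.**
[cite: SerreLocalFields1979, Ch. IV §2 Prop. 6] -/
theorem norm_one_sub_pow_prime_eq {y : K} {k : ℕ} (hy : ‖1 - y‖ = ‖(ϖ : K)‖ ^ k) (hk : k < s) :
    ‖1 - y ^ p‖ = ‖(ϖ : K)‖ ^ (p * k) := by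
  have h := norm_one_add_pow_prime_sub_one_eq p hϖ he (w := -(1 - y)) (by rwa [norm_neg]) hk
  have hw : (1 : K) + -(1 - y) = y := by ring
  rwa [hw, ← norm_neg, neg_sub] at h

/-- Iterated: **`‖1 − y‖ = ‖ϖ‖ᵏ` and `pᵗ·k < p·s` (i.e. `p^{t−1}k < s`) ⇒ `‖1 − y^{pᵗ}‖ = ‖ϖ‖^{pᵗk}`.**
[cite: SerreLocalFields1979, Ch. IV §2 Prop. 6] -/
theorem norm_one_sub_pow_prime_pow_eq {y : K} {k : ℕ} (hy : ‖1 - y‖ = ‖(ϖ : K)‖ ^ k) :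
    ∀ t : ℕ, p ^ t * k < p * s → ‖1 - y ^ p ^ t‖ = ‖(ϖ : K)‖ ^ (p ^ t * k) := by
  intro t
  induction t with
  | zero => intro _; simpa using hy
  | succ t ih =>
    intro ht
    have hlt : p ^ t * k < s := by
      rw [pow_succ] at ht
      have h' : p * (p ^ t * k) < p * s := by
        calc p * (p ^ t * k) = p ^ t * p * k := by ring
          _ < p * s := ht
      exact Nat.lt_of_mul_lt_mul_left h'
    have hprev : p ^ t * k < p * s :=
      lt_of_lt_of_le hlt (Nat.le_mul_of_pos_left s hp.out.pos)
    have h := norm_one_sub_pow_prime_eq p hϖ he (ih hprev) hlt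
    rw [← pow_mul] at h
    rw [pow_succ, h]
    congr 1
    ring

/-- **At (or above) the tie level the `p`-th power lands strictly inside it**: `‖1 − y‖ ≤ ‖ϖ‖ˢ ⇒
‖1 − y^p‖ ≤ ‖ϖ‖^{s+1}` (`‖w^p‖ ≤ ‖ϖ‖^{ps}`, `‖pwR‖ ≤ ‖ϖ‖^{e+s}`, both exponents `≥ s + 1`).
[cite: NeukirchANT1999, Ch. II Prop. (5.5)] -/
theorem norm_one_sub_pow_prime_le_of_le {y : K} (hy : ‖1 - y‖ ≤ ‖(ϖ : K)‖ ^ s) :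
    ‖1 - y ^ p‖ ≤ ‖(ϖ : K)‖ ^ (s + 1) := by
  have hr0 : 0 < ‖(ϖ : K)‖ := norm_units_pos ϖ
  have hr1 : ‖(ϖ : K)‖ < 1 := hϖ.norm_lt_one
  have h1 := one_le_level p he
  have hp2 : 2 ≤ p := hp.out.two_le
  set w : K := -(1 - y) with hw
  have hwn : ‖w‖ ≤ ‖(ϖ : K)‖ ^ s := by rwa [hw, norm_neg]
  have hw1 : ‖w‖ ≤ 1 := hwn.trans (pow_le_one₀ hr0.le hr1.le)
  have hy' : y = 1 + w := by rw [hw]; ring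
  have hA : ‖w ^ p‖ ≤ ‖(ϖ : K)‖ ^ (s + 1) := by
    rw [norm_pow]
    calc ‖w‖ ^ p ≤ (‖(ϖ : K)‖ ^ s) ^ p := by gcongr
      _ = ‖(ϖ : K)‖ ^ (s * p) := by rw [pow_mul]
      _ ≤ ‖(ϖ : K)‖ ^ (s + 1) := pow_le_pow_of_le_one hr0.le hr1.le (by nlinarith)
  have hB : ‖(1 + w) ^ p - 1 - w ^ p‖ ≤ ‖(ϖ : K)‖ ^ (s + 1) := by
    refine (norm_one_add_pow_prime_sub_sub_le p hw1).trans ?_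
    rw [norm_prime_eq_norm_pow_level p hϖ he]
    calc ‖(ϖ : K)‖ ^ (s * (p - 1)) * ‖w‖ ≤ ‖(ϖ : K)‖ ^ (s * (p - 1)) * ‖(ϖ : K)‖ ^ s := by gcongr
      _ = ‖(ϖ : K)‖ ^ (s * (p - 1) + s) := by rw [pow_add]
      _ ≤ ‖(ϖ : K)‖ ^ (s + 1) := pow_le_pow_of_le_one hr0.le hr1.le (by
          have : 1 ≤ s * (p - 1) := Nat.one_le_iff_ne_zero.mpr (by
            apply Nat.mul_ne_zero <;> omega)
          omega)
  rw [hy', show (1 : K) - (1 + w) ^ p = -(((1 + w) ^ p - 1 - w ^ p) + w ^ p) by ring, norm_neg]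
  exact (norm_add_le_max _ _).trans (max_le hB hA)

end PthPower

/-! ## 5. Non-trivial `p`-th roots of unity at a tie-level field (any `s`) -/

section Roots

variable {ϖ : Kˣ} (hϖ : IsUniformizer ϖ) {s : ℕ} (he : absRamificationIdx p K = s * (p - 1))
include hϖ he

/-- **`‖1 − ζ‖ = ‖ϖ‖ˢ` EXACTLY** for a NON-TRIVIAL `p`-th root of unity (`‖1 − ζ‖^{p−1} = ‖p‖ = ‖ϖ‖^{s(p−1)}`,
abc-iut-w5-d039's `norm_one_sub_pow_eq_norm_prime_of_isPrimitiveRoot`). [cite: NeukirchANT1999, Ch. II Prop. (7.13)]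
[cite: Washington1997, Lemma 1.4] -/
theorem norm_one_sub_eq_pow_of_pow_prime_eq_one {ζ : K} (hζ : ζ ^ p = 1) (hζ1 : ζ ≠ 1) :
    ‖1 - ζ‖ = ‖(ϖ : K)‖ ^ s := by
  have hprim : IsPrimitiveRoot ζ p := by
    have hord : orderOf ζ = p := orderOf_eq_prime hζ hζ1
    exact hord ▸ IsPrimitiveRoot.orderOf ζ
  have h := norm_one_sub_pow_eq_norm_prime_of_isPrimitiveRoot p K hprim
  rw [norm_prime_eq_norm_pow_level p hϖ he, pow_mul] at h
  have hq0 : p - 1 ≠ 0 := by have := hp.out.two_le; omega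
  exact (pow_left_inj₀ (norm_nonneg _) (by positivity) hq0).mp h

/-- **A non-trivial `p`-th root of unity yields a UNIT ZERO of the residue polynomial**: with
`a₁ := (ζ − 1)/ϖˢ` one has `‖a₁‖ = 1`, `1 + ϖˢ·a₁ = ζ` and `a₁ + c·a₁^p ∈ 𝔪` (`c = ϖ^{s(p−1)}/p`), because
`log_p(1 + ϖˢa₁) = log_p ζ = 0 ∈ 𝔪^{s+1}`. [cite: Washington1997, §5.1] -/
theorem exists_norm_eq_one_norm_add_mul_pow_lt_one (hp2 : p ≠ 2) {ζ : K} (hζ : ζ ^ p = 1) (hζ1 : ζ ≠ 1) :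
    ∃ a : K, ‖a‖ = 1 ∧ 1 + (ϖ : K) ^ s * a = ζ ∧ ‖a + ((ϖ : K) ^ s) ^ (p - 1) / p * a ^ p‖ < 1 := by
  have hϖ0 : (ϖ : K) ^ s ≠ 0 := pow_ne_zero _ ϖ.ne_zero
  have hn := norm_one_sub_eq_pow_of_pow_prime_eq_one p hϖ he hζ hζ1
  have ha1 : ‖(ζ - 1) / (ϖ : K) ^ s‖ = 1 := by
    rw [norm_div, ← norm_neg, neg_sub, hn, norm_pow, div_self (pow_ne_zero _ (norm_ne_zero_iff.mpr ϖ.ne_zero))]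
  refine ⟨(ζ - 1) / (ϖ : K) ^ s, ha1, ?_, ?_⟩
  · field_simp; ring
  · refine norm_lt_one_of_norm_logSeries_le_pow_succ p hϖ he hp2 ha1.le ?_
    rw [mul_div_cancel₀ _ hϖ0, add_sub_cancel, logSeries_eq_zero_of_pow_prime_eq_one p hζ, norm_zero]
    positivity

/-- **LIFTING**: a unit `a` with `a + c·a^p ∈ 𝔪` produces a NON-TRIVIAL `p`-th root of unity in `K`.
Proof: `log_p(1 + ϖˢa) ∈ 𝔪^{s+1} = log_p(U^{(s+1)})`, so `1 + ϖˢa = ζ·u` with `u ∈ U^{(s+1)}` and `log_p ζ = 0`;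
`‖1 − ζ‖ = ‖ϖ‖ˢ` so `ζ ≠ 1`; `ζ^p ∈ U^{(s+1)}` (§4) with `log_p(ζ^p) = p·log_p ζ = 0 = log_p 1`, so `ζ^p = 1` by
injectivity on `U^{(s+1)}`. [cite: Washington1997, Lemma 1.4, §5.1] [cite: Koblitz1984, Ch. IV §2] -/
theorem exists_pow_prime_eq_one_of_norm_add_mul_pow_lt_one (hp2 : p ≠ 2) {a : K} (ha : ‖a‖ = 1)
    (hΛ : ‖a + ((ϖ : K) ^ s) ^ (p - 1) / p * a ^ p‖ < 1) : ∃ ζ : K, ζ ^ p = 1 ∧ ζ ≠ 1 := by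
  set r := ‖(ϖ : K)‖ ^ s with hr
  have hr0 : 0 < r := pow_pos (norm_units_pos ϖ) s
  have hrr : ‖(ϖ : K)‖ ^ (s + 1) < r := by
    rw [hr, pow_succ]
    exact mul_lt_of_lt_one_right hr0 hϖ.norm_lt_one
  set y₀ : K := 1 + (ϖ : K) ^ s * a with hy₀
  have hx₀ : ‖(ϖ : K) ^ s * a‖ = r := by rw [norm_mul, ha, mul_one, norm_pow]
  have hy₀1 : ‖1 - y₀‖ = r := by rw [hy₀, sub_add_cancel_left, norm_neg, hx₀]
  have hy₀P : IsPrincipal y₀ := isPrincipal_one_add_pow_mul p hϖ he ha.le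
  -- `L(y₀) ∈ 𝔪^{s+1}`, hence `= L(u₁)` with `u₁ ∈ U^{(s+1)}`
  have hL := norm_logSeries_le_pow_succ_of_norm_lt_one p hϖ he hp2 ha.le hΛ
  obtain ⟨u₁, hu₁, hLu⟩ := exists_logSeries_eq_of_norm_le_pow_succ p hϖ he hL
  have hu₁P : IsPrincipal u₁ :=
    hu₁.trans_lt (pow_lt_one₀ (norm_nonneg _) hϖ.norm_lt_one (Nat.succ_ne_zero s))
  have hu₁n : ‖u₁‖ = 1 := hu₁P.norm_eq_one
  have hu₁0 : u₁ ≠ 0 := norm_pos_iff.mp (by rw [hu₁n]; exact one_pos)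
  set ζ : K := y₀ * u₁⁻¹ with hζ
  have hζP : IsPrincipal ζ := hy₀P.mul hu₁P.inv
  -- `L(ζ) = 0`
  have hLinv : logSeries u₁⁻¹ = -logSeries u₁ := by
    have h := logSeries_mul p hu₁P hu₁P.inv
    rw [mul_inv_cancel₀ hu₁0, logSeries_one] at h
    linear_combination -h
  have hLζ : logSeries ζ = 0 := by
    rw [hζ, logSeries_mul p hy₀P hu₁P.inv, hLinv, hLu, add_neg_cancel]
  -- `‖1 - ζ‖ = r`, so `ζ ≠ 1`
  have h1ζ : ‖1 - ζ‖ = r := by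
    have hrew : 1 - ζ = ((u₁ - 1) + (1 - y₀)) * u₁⁻¹ := by
      rw [hζ]; field_simp; ring
    have hlt : ‖u₁ - 1‖ < ‖1 - y₀‖ := by
      rw [hy₀1, ← norm_neg, neg_sub]
      exact hu₁.trans_lt hrr
    rw [hrew, norm_mul, norm_inv, hu₁n, inv_one, mul_one,
      norm_add_eq_max_of_norm_ne_norm hlt.ne, max_eq_right hlt.le, hy₀1]
  refine ⟨ζ, ?_, fun h => ?_⟩
  · -- `ζ^p ∈ U^{(s+1)}`, `L(ζ^p) = 0 = L(1)`
    have hpow : ‖1 - ζ ^ p‖ ≤ ‖(ϖ : K)‖ ^ (s + 1) := norm_one_sub_pow_prime_le_of_le p hϖ he h1ζ.le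
    have hLp : logSeries (ζ ^ p) = logSeries 1 := by
      rw [logSeries_pow p hζP, hLζ, mul_zero, logSeries_one]
    have h1 : (1 : K) ∈ {y : K | ‖1 - y‖ ≤ ‖(ϖ : K)‖ ^ (s + 1)} := by
      rw [Set.mem_setOf_eq, sub_self, norm_zero]; positivity
    exact logSeries_injOn_pow_succ p hϖ he hpow h1 hLp
  · rw [h, sub_self, norm_zero] at h1ζ
    exact hr0.ne h1ζ

/-- Contrapositive, the form consumed below: **if `K` has no non-trivial `p`-th root of unity then the
residue polynomial `ā ↦ ā + c̄·ā^p` has trivial kernel** — `‖a‖ ≤ 1`, `a + c·a^p ∈ 𝔪 ⇒ a ∈ 𝔪`.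
[cite: Washington1997, §5.1] -/
theorem norm_lt_one_of_norm_add_mul_pow_lt_one (hp2 : p ≠ 2) (hμ : ∀ ζ : K, ζ ^ p = 1 → ζ = 1)
    {a : K} (ha : ‖a‖ ≤ 1) (hΛ : ‖a + ((ϖ : K) ^ s) ^ (p - 1) / p * a ^ p‖ < 1) : ‖a‖ < 1 := by
  by_contra hge
  have ha1 : ‖a‖ = 1 := le_antisymm ha (not_lt.mp hge)
  obtain ⟨ζ, hζ, hζ1⟩ := exists_pow_prime_eq_one_of_norm_add_mul_pow_lt_one p hϖ he hp2 ha1 hΛ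
  exact hζ1 (hμ ζ hζ)

/-- **THE ROOT-OF-UNITY CRITERION at a tie-level field** (`e = s(p−1)`, `p` odd): `K` contains a non-trivial
`p`-th root of unity iff the residue polynomial `ā ↦ ā + c̄·ā^p` (`c = ϖ^{s(p−1)}/p`) has a UNIT zero.
[cite: Washington1997, Lemma 1.4, §5.1] [cite: NeukirchANT1999, Ch. II Prop. (5.7)] -/
theorem exists_pow_prime_eq_one_ne_one_iff_exists_unit_zero (hp2 : p ≠ 2) :
    (∃ ζ : K, ζ ^ p = 1 ∧ ζ ≠ 1) ↔
      ∃ a : K, ‖a‖ = 1 ∧ ‖a + ((ϖ : K) ^ s) ^ (p - 1) / p * a ^ p‖ < 1 := by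
  constructor
  · rintro ⟨ζ, hζ, hζ1⟩
    obtain ⟨a, ha, -, hΛ⟩ := exists_norm_eq_one_norm_add_mul_pow_lt_one p hϖ he hp2 hζ hζ1
    exact ⟨a, ha, hΛ⟩
  · rintro ⟨a, ha, hΛ⟩
    exact exists_pow_prime_eq_one_of_norm_add_mul_pow_lt_one p hϖ he hp2 ha hΛ

end Roots

end FirstTieLevel

end Literature.IUT.LogVolume

end
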